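import Literature.AnabelianGeometry.AbsoluteAnabelian.AbsTopIII.CcnTransgressionSurjective
import Literature.AnabelianGeometry.AbsoluteAnabelian.AbsTopIII.CuspidalSynchronizationHolds
import HarnessLib

/-!
# [AbsTopIII] Prop. 1.4 (ii), `∃`-form (`Prop_1_4_ii_sync`, FACT-LIST F-0365) AT THE PRINTED INSTANCE CLASS

Mochizuki, *Topics in Absolute Anabelian Geometry III*, §1, Prop. 1.4 (ii), manuscript pp. 31–32 (lit
key `paper:url-5493eb38cbb7`): "this last element corresponds to the natural isomorphism `M_X ⥲ I_x`
[...]. In particular, this yields a 'purely group-theoretic algorithm' [...] for constructing this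
isomorphism from the surjection `Δ_{U_x} ↠ Δ_X`."

PROOF-ONLY companion (no definitions) of `GeometricCyclotome.lean` (abc-iut-L4-t1, p408196), whose named
fact `CurveModel.Prop_1_4_ii_sync M` (FACT-LIST F-0365) asserts, for every cyclotome presentation
`(U_x ⊆ X, x)` of a model `M : CurveModel`, the EXISTENCE of a `Π_{U_x}`-equivariant identification
`M_X = Hom(H²(Δ_X, Ẑ), Ẑ) ≅ I_x`.  Its universal closure over all models is REFUTED
(`CurveModel.not_forall_prop_1_4_ii_sync`, `GeometricCyclotomeSyncSchema.lean`, p429501); its reduction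
`CurveModel.prop_1_4_ii_sync_of_transgression : Prop_1_4_i' → Prop_1_4_ii_transgression → Prop_1_4_ii_sync`
(`CuspidalSynchronizationHolds.lean`) rested on the two named facts F-0340 and F-0338.  Here:

* `CurveModel.prop_1_4_ii_sync_of_surjOn` — the reduction re-run with the surjection `Δ_{U_x} ↠ Δ_X`
  at cyclotome presentations in place of `Prop_1_4_i'` (the only use of Prop. 1.4 (i) in the
  derivation is the existence of a continuous section of `Δ^{c-cn}_{U_x} ↠ Δ_X`, `nonempty_ccnSection`);
* **`CurveModel.prop_1_4_ii_sync_of_instanceClass`** — composing with abc-iut-f-076's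
  `CurveModel.prop_1_4_ii_transgression_of_instanceClass` (`CcnTransgressionSurjective.lean`, p432607:
  F-0338 at the instance class): **`Prop_1_4_ii_sync M` holds for every model all of whose cyclotome
  presentations have `Δ_{U_x} ↠ Δ_X`, `I_x ≤ [Δ_{U_x}, Δ_{U_x}]⁻` and `H²(Δ_{U_x}, Ẑ) = 0`** — the named
  fact F-0365 DISCHARGED at the printed instance class modulo exactly the three transparent structural
  inputs of F-0338's discharge (what the geometry of a once-punctured proper curve supplies in print:
  `Δ_U` free profinite for affine `U`, [AbsTopI] Lem. 4.5 (i); `Δ_{U_x}^{ab} = Δ_X^{ab}`), with NO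
  Prop. 1.4 (i) binder;
* `CurveModel.prop_1_4_ii_sync_of_prop_1_4_i'_of_instanceClass` — the same with the surjection supplied
  by the named fact `Prop_1_4_i'` (F-0340, kept BY NAME) for consumers that carry it.

HONEST FRAMING: refereed pre-IUT material ([AbsTopIII] §1) plus the tree's generic continuous
cohomology; a FACT row is an assumption label, proved = OUR kernel check of the typed statement at the
stated instance class; nothing here bears on [IUTchIII] Cor. 3.12; typed ≠ proved.
-/

noncomputable section

open CategoryTheory

universe u

namespace Literature.AnabelianGeometry.AbsoluteAnabelian.AbsTopIII

namespace CurveModel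

variable (M : CurveModel.{u})

/-- **`Prop_1_4_ii_sync` from the surjections `Δ_{U_x} ↠ Δ_X` and the natural form of Prop. 1.4 (ii).**
If at every cyclotome presentation `(U_x ⊆ X, x)` of the model the cuspidal quotient maps `Δ_{U_x}` onto
`Δ_X` ("the surjection `Δ_{U_x} ↠ Δ_X`", p. 32 — all that is needed for a continuous section of
`Δ^{c-cn}_{U_x} ↠ Δ_X`) and the differential of Prop. 1.4 (ii) is bijective
(`Prop_1_4_ii_transgression`), then the `∃`-shaped synchronization fact `Prop_1_4_ii_sync` holds —
witnessed by THE natural synchronization (proof of `prop_1_4_ii_sync_of` with the section taken from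
`nonempty_ccnSection` and `I_x ≅ Ẑ` from `nonempty_inertiaEquivZHat`).
[cite: MochizukiAbsTopIII2015, Prop 1.4 (ii) p.32] -/
theorem prop_1_4_ii_sync_of_surjOn
    (hq : ∀ (Ux X : M.Curve) (h : M.IsCofiniteOpen Ux X) (x : (M.cusps Ux).Cusp),
      M.IsCyclotomePresentation h x → Set.SurjOn (M.res h).arith (M.ext Ux).geom (M.ext X).geom)
    (hT : M.Prop_1_4_ii_transgression) :
    M.Prop_1_4_ii_sync := by
  intro Ux X h x hp
  obtain ⟨s⟩ := nonempty_ccnSection (M.res h) (hq Ux X h x hp)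
  have hd := hT Ux X h x hp s
  obtain ⟨e₀⟩ := M.nonempty_inertiaEquivZHat h x hp
  let e := kerEquivZHatOfInertia hp.isCuspidallyCentral ((M.cusps Ux).isClosed_Icusp x) e₀
  have hbij := synchronizationOfBijective_bijective (M.res h) s hd e
  let ψ : Additive (ContinuousCohomology.extKer (deltaCcnProjₜ (M.res h))) ≃+
      geomCyclotomeDual (M.ext X) ZHatCoeff.{u} := AddEquiv.ofBijective _ hbij
  let κ : Additive (ContinuousCohomology.extKer (deltaCcnProjₜ (M.res h))) ≃+
      Additive (geomCyclotome (M.res h)) := MulEquiv.toAdditive (extKerEquivGeomCyclotome (M.res h))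
  refine ⟨ψ.symm.trans κ, fun g m => ?_⟩
  -- write `m = ψ a`
  obtain ⟨a, rfl⟩ : ∃ a, ψ a = m := ⟨ψ.symm m, ψ.apply_symm_apply m⟩
  have hconj : ψ (extKerConj (M.res h) g a) =
      M.cyclotomeActionOfOpen h ZHatCoeff.{u} g (ψ a) :=
    synchronizationOfBijective_conj (M.res h) s hd g a
  rw [← hconj, AddEquiv.trans_apply, AddEquiv.trans_apply, AddEquiv.symm_apply_apply,
    AddEquiv.symm_apply_apply]
  apply Subtype.ext
  rw [MulAut.conjNormal_apply]
  rfl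

/-- **[AbsTopIII] Prop. 1.4 (ii), `∃`-form — the named fact `Prop_1_4_ii_sync M` (FACT-LIST F-0365) AT
THE PRINTED INSTANCE CLASS.**  For every model `M` all of whose cyclotome presentations
`(U_x ⊆ X, x)` satisfy the three structural inputs of a once-punctured proper curve —
`Δ_{U_x} ↠ Δ_X` (the cuspidal quotient is surjective on geometric fundamental groups),
`I_x ≤ [Δ_{U_x}, Δ_{U_x}]⁻` (one puncture: `Δ_{U_x}^{ab} = Δ_X^{ab}`) and `H²(Δ_{U_x}, Ẑ) = 0`
(`Δ_{U_x}` free profinite, [AbsTopI] Lem. 4.5 (i)) — there is, for every cyclotome presentation, a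
`Π_{U_x}`-equivariant isomorphism `M_X = Hom(H²(Δ_X, Ẑ), Ẑ) ≅ I_x` ("this last element corresponds to
the natural isomorphism `M_X ⥲ I_x`", pp. 31–32): `prop_1_4_ii_sync_of_surjOn` composed with
abc-iut-f-076's `prop_1_4_ii_transgression_of_instanceClass` (bijectivity of the differential at this
instance class).  No Prop. 1.4 (i) binder. [cite: MochizukiAbsTopIII2015, Prop 1.4 (ii) p.31] -/
theorem prop_1_4_ii_sync_of_instanceClass
    (hq : ∀ (Ux X : M.Curve) (h : M.IsCofiniteOpen Ux X) (x : (M.cusps Ux).Cusp),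
      M.IsCyclotomePresentation h x → Set.SurjOn (M.res h).arith (M.ext Ux).geom (M.ext X).geom)
    (hI : ∀ (Ux X : M.Curve) (h : M.IsCofiniteOpen Ux X) (x : (M.cusps Ux).Cusp),
      M.IsCyclotomePresentation h x →
        (M.cusps Ux).Icusp x ≤ (⁅(M.ext Ux).geom, (M.ext Ux).geom⁆).topologicalClosure)
    (hH2 : ∀ (Ux X : M.Curve) (h : M.IsCofiniteOpen Ux X) (x : (M.cusps Ux).Cusp),
      M.IsCyclotomePresentation h x → Subsingleton (geomH2 (M.ext Ux) ZHatCoeff.{u})) :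
    M.Prop_1_4_ii_sync :=
  M.prop_1_4_ii_sync_of_surjOn hq (M.prop_1_4_ii_transgression_of_instanceClass hq hI hH2)

/-- **F-0365 modulo F-0340 by name, F-0338 discharged at the instance class.**  For a model satisfying
the named fact `Prop_1_4_i'` (Prop. 1.4 (i): the cuspidal quotients `Π_U ↠ Π_{U'}` are surjective with
bijective Galois part — which gives `Δ_{U_x} ↠ Δ_X`, `surjOn_geom_res`) all of whose cyclotome
presentations have `I_x ≤ [Δ_{U_x}, Δ_{U_x}]⁻` and `H²(Δ_{U_x}, Ẑ) = 0`, the synchronization fact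
`Prop_1_4_ii_sync M` holds. [cite: MochizukiAbsTopIII2015, Prop 1.4 (ii) p.31] -/
theorem prop_1_4_ii_sync_of_prop_1_4_i'_of_instanceClass (h14 : M.Prop_1_4_i')
    (hI : ∀ (Ux X : M.Curve) (h : M.IsCofiniteOpen Ux X) (x : (M.cusps Ux).Cusp),
      M.IsCyclotomePresentation h x →
        (M.cusps Ux).Icusp x ≤ (⁅(M.ext Ux).geom, (M.ext Ux).geom⁆).topologicalClosure)
    (hH2 : ∀ (Ux X : M.Curve) (h : M.IsCofiniteOpen Ux X) (x : (M.cusps Ux).Cusp),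
      M.IsCyclotomePresentation h x → Subsingleton (geomH2 (M.ext Ux) ZHatCoeff.{u})) :
    M.Prop_1_4_ii_sync :=
  M.prop_1_4_ii_sync_of_instanceClass
    (fun _ _ h _ hp => M.surjOn_geom_res h14 h hp.isScheme.1 hp.isScheme.2) hI hH2

end CurveModel

end Literature.AnabelianGeometry.AbsoluteAnabelian.AbsTopIII
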